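import Summits.ValiantsHypothesis.ValiantsHypothesis.Theorems.LacunarySymmetroidMatrixDescartesCensusPivotTwoNormalForm
import Summits.ValiantsHypothesis.ValiantsHypothesis.Theorems.LacunarySymmetroidMatrixDescartesCensusPivotKit

/-!
# `MatrixDescartes` census — pivot column at `m = 2`: the SCALAR ENVELOPE of the indefinite pivot
# (`u > 0` is a determinant root ⟺ `u^e = β̃(u) + 2 √(p̃(u) r̃(u))`; the `2K` law is a statement about ONE real equation)

HONEST FRAMING.  Object-search cell `pub-symmetroid`, Conjecture-B column in PIVOT currency (`…CensusPivotDefs.lean`, seat conjb-1),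
seat `val-sym-mdr-p1` (generation 7).  Helper file landed `--supports` the crux item stmt-ValiantsHypothesis-18050
(`Theses.LacunarySymmetroid.MatrixDescartes`, OPEN, on HOLD) with NO closure claim.  By `…PivotTwoDefinitePivot` (g6) and
`…PivotTwoNormalForm` (this seat) the open content of the `(2, K)` pivot rows «`Z₊ ≤ 2K`» is the single pivot letter
`J₀ = diag(−1, 1)`.  For `F(u) = u^e J₀ + A(u)`, `A(u) = ∑ₖ u^{dₖ} Pₖ ⪰ 0`, write in the LIGHT-CONE FRAME of `J₀`
  `p̃(u) = ¼ (1,1) A(u) (1,1)ᵀ`,  `r̃(u) = ¼ (1,−1) A(u) (1,−1)ᵀ`,  `β̃(u) = ½ (A(u)₀₀ − A(u)₁₁)`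
— three `K`-nomials `∑ₖ p̃ₖ u^{dₖ}`, `∑ₖ r̃ₖ u^{dₖ}`, `∑ₖ β̃ₖ u^{dₖ}` on the SAME support whose letters lie in the cone
`p̃ₖ, r̃ₖ ≥ 0`, `β̃ₖ² ≤ 4 p̃ₖ r̃ₖ` (`4 p̃ₖ r̃ₖ − β̃ₖ² = det Pₖ`).  This file proves (g6's paper reformulation §4(a) made kernel):

* `det_eval_normalForm`: `det F(u) = (α(u) − u^e)(ν(u) + u^e) − β̂(u)²` (`α, ν, β̂` the entries of `A(u)`).
* **`isRoot_iff_pow_eq_envelope`**: for `u > 0`, `det F(u) = 0 ⟺ u^e = β̃(u) + 2 √(p̃(u) r̃(u))` (the other root of the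
  quadratic in `u^e` is `≤ 0`), and **`det_nonneg_iff_pow_le_envelope`**: `det F(u) ≥ 0 ⟺ u^e ≤ β̃(u) + 2 √(p̃(u) r̃(u))`
  (`F(u)` is never negative semidefinite, so this is `F(u) ⪰ 0`).
* **ENVELOPE** (`envelope_le_posynomial`, `exists_envelope_eq_posynomial`): `β̃ + 2√(p̃ r̃) = min over z ∈ ℝ` of the
  POSYNOMIALS `∑ₖ (e^z p̃ₖ + β̃ₖ + e^{−z} r̃ₖ) u^{dₖ}` (non-negative coefficients, `coeff_posynomial_nonneg`) — AM–GM.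
  Hence at a root `u^e ≤ ∑ₖ cₖ(z) u^{dₖ}` for every `z` (`pow_le_posynomial_of_isRoot`).
* **SCALAR REDUCTION** (`pivotPosRoots_normalForm_le_card`, `pivotRootLawAt_two_of_scalar`): any finite set containing the
  positive solutions of `u^e = ∑ β̃ₖu^{dₖ} + 2√((∑ p̃ₖu^{dₖ})(∑ r̃ₖu^{dₖ}))` bounds `Z₊`; so if for all cone data
  `(pₖ, rₖ, bₖ)` that scalar equation has `≤ 2K` positive solutions, `PivotRootLawAt 2 K q (2K)` holds for every `q`.

Located remark (paper, seat NOTES): in `t = log u` the sublevel set `{(t,z) : ∑ₖ cₖ(z)e^{(dₖ−e)t} < 1}` has interval slices in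
`t` and in `z`, so its components («islands») have disjoint projections and `Z₊ = 2 · #islands` generically — the `2K`
law says «at most `K` islands».  Nothing here bears on `Theses.LacunarySymmetroid.MatrixDescartes` in its window, on
`KPlusLogSqLaw`, on `DoorA26` / `DoorA34`, on the cell's registers or credences, or on `VP ≠ VNP`.

[folklore] Elementary (a quadratic equation, AM–GM).  No definitions, no named facts.
-/

-- `Summit.ValiantsHypothesis.ValiantsHypothesis.…` repeats a component by the D-0017 layout
-- (single-conjunct summit), which the `dupNamespace` linter flags; the name is mandated.
set_option linter.dupNamespace false

namespace Summit.ValiantsHypothesis.ValiantsHypothesis.Theorems.LacunarySymmetroidMatrixDescartes.Pivot.TwoEnvelope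

open Matrix Finset Polynomial
open scoped BigOperators

/-! ## The scalar quadratic `(a − x)(n + x) − c²` with `a, n ≥ 0`, `c² ≤ a n` -/

section scalar

/-- The discriminant `(a + n)² − 4c²` is non-negative when `c² ≤ a n`. [folklore] -/
theorem disc_nonneg {a n c : ℝ} (hac : c * c ≤ a * n) : 0 ≤ (a + n) ^ 2 - 4 * c ^ 2 := by
  nlinarith [sq_nonneg (a - n)]

/-- Completing the square: `(a − x)(n + x) − c² = ¼((a+n)² − 4c²) − (x − (a−n)/2)²`. [folklore] -/
theorem quad_eq_sq_sub (a n c x : ℝ) :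
    (a - x) * (n + x) - c * c = ((a + n) ^ 2 - 4 * c ^ 2) / 4 - (x - (a - n) / 2) ^ 2 := by
  ring

/-- For `x > 0` and `c² ≤ a n`: `(a − x)(n + x) − c² = 0 ⟺ x = (a − n)/2 + ½√((a+n)² − 4c²)`
(the conjugate root `(a − n)/2 − ½√(…)` is `≤ 0`). [folklore] -/
theorem quad_eq_zero_iff {a n c x : ℝ} (hac : c * c ≤ a * n) (hx : 0 < x) :
    (a - x) * (n + x) - c * c = 0 ↔ x = (a - n) / 2 + Real.sqrt ((a + n) ^ 2 - 4 * c ^ 2) / 2 := by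
  set S := Real.sqrt ((a + n) ^ 2 - 4 * c ^ 2) with hS
  have hS0 : 0 ≤ S := Real.sqrt_nonneg _
  have hSS : S * S = (a + n) ^ 2 - 4 * c ^ 2 := Real.mul_self_sqrt (disc_nonneg hac)
  have hSge : a - n ≤ S := by
    -- `S² = (a−n)² + 4(an − c²) ≥ (a−n)²`
    by_contra hlt
    push Not at hlt
    nlinarith [hSS, hlt, hS0]
  have hfac : (a - x) * (n + x) - c * c = -((x - ((a - n) / 2 + S / 2)) * (x - ((a - n) / 2 - S / 2))) := by
    rw [quad_eq_sq_sub]; nlinarith [hSS]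
  constructor
  · intro h
    rw [hfac, neg_eq_zero, mul_eq_zero] at h
    rcases h with h | h
    · linarith
    · exfalso; linarith
  · intro h
    rw [hfac, h]; ring

/-- For `x > 0` and `c² ≤ a n`: `0 ≤ (a − x)(n + x) − c² ⟺ x ≤ (a − n)/2 + ½√((a+n)² − 4c²)`. [folklore] -/
theorem quad_nonneg_iff {a n c x : ℝ} (hac : c * c ≤ a * n) (hx : 0 < x) :
    0 ≤ (a - x) * (n + x) - c * c ↔ x ≤ (a - n) / 2 + Real.sqrt ((a + n) ^ 2 - 4 * c ^ 2) / 2 := by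
  set S := Real.sqrt ((a + n) ^ 2 - 4 * c ^ 2) with hS
  have hS0 : 0 ≤ S := Real.sqrt_nonneg _
  have hSS : S * S = (a + n) ^ 2 - 4 * c ^ 2 := Real.mul_self_sqrt (disc_nonneg hac)
  have hSge : a - n ≤ S := by
    by_contra hlt
    push Not at hlt
    nlinarith [hSS, hlt, hS0]
  have hfac : (a - x) * (n + x) - c * c = ((a - n) / 2 + S / 2 - x) * (x - ((a - n) / 2 - S / 2)) := by
    rw [quad_eq_sq_sub]; nlinarith [hSS]
  have hpos : 0 < x - ((a - n) / 2 - S / 2) := by linarith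
  rw [hfac]
  constructor
  · intro h
    by_contra hlt
    push Not at hlt
    have : ((a - n) / 2 + S / 2 - x) * (x - ((a - n) / 2 - S / 2)) < 0 := mul_neg_of_neg_of_pos (by linarith) hpos
    linarith
  · intro h
    exact mul_nonneg (by linarith) hpos.le

/-- Light-cone form of the envelope: with `p = (a + n + 2c)/4`, `r = (a + n − 2c)/4`,
`½√((a+n)² − 4c²) = 2√(p r)`. [folklore] -/
theorem half_sqrt_disc_eq (a n c : ℝ) :
    Real.sqrt ((a + n) ^ 2 - 4 * c ^ 2) / 2 = 2 * Real.sqrt ((a + n + 2 * c) / 4 * ((a + n - 2 * c) / 4)) := by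
  have h : (a + n) ^ 2 - 4 * c ^ 2 = 16 * ((a + n + 2 * c) / 4 * ((a + n - 2 * c) / 4)) := by ring
  rw [h, Real.sqrt_mul (by norm_num : (0:ℝ) ≤ 16), show (16 : ℝ) = 4 ^ 2 by norm_num,
    Real.sqrt_sq (by norm_num : (0:ℝ) ≤ 4)]
  ring

/-- **AM–GM envelope**: for `p, r ≥ 0` and every `z`, `2√(p r) ≤ e^z p + e^{−z} r`. [folklore] -/
theorem two_sqrt_mul_le_exp (p r z : ℝ) (hp : 0 ≤ p) (hr : 0 ≤ r) :
    2 * Real.sqrt (p * r) ≤ Real.exp z * p + Real.exp (-z) * r := by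
  have hE : Real.exp z * Real.exp (-z) = 1 := by rw [← Real.exp_add, add_neg_cancel, Real.exp_zero]
  have h1 : Real.sqrt (p * r) = Real.sqrt (Real.exp z * p) * Real.sqrt (Real.exp (-z) * r) := by
    rw [← Real.sqrt_mul (mul_nonneg (Real.exp_pos z).le hp)]
    congr 1
    calc p * r = (Real.exp z * Real.exp (-z)) * (p * r) := by rw [hE, one_mul]
      _ = Real.exp z * p * (Real.exp (-z) * r) := by ring
  rw [h1]
  nlinarith [sq_nonneg (Real.sqrt (Real.exp z * p) - Real.sqrt (Real.exp (-z) * r)),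
    Real.mul_self_sqrt (mul_nonneg (Real.exp_pos z).le hp),
    Real.mul_self_sqrt (mul_nonneg (Real.exp_pos (-z)).le hr)]

/-- The envelope is attained: for `p, r > 0` there is `z` (namely `e^z = √(r/p)`) with `2√(p r) = e^z p + e^{−z} r`.
[folklore] -/
theorem exists_two_sqrt_mul_eq_exp (p r : ℝ) (hp : 0 < p) (hr : 0 < r) :
    ∃ z : ℝ, 2 * Real.sqrt (p * r) = Real.exp z * p + Real.exp (-z) * r := by
  have hsp : 0 < Real.sqrt p := Real.sqrt_pos.2 hp
  have hsr : 0 < Real.sqrt r := Real.sqrt_pos.2 hr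
  have hp' : Real.sqrt p * Real.sqrt p = p := Real.mul_self_sqrt hp.le
  have hr' : Real.sqrt r * Real.sqrt r = r := Real.mul_self_sqrt hr.le
  refine ⟨Real.log (Real.sqrt r / Real.sqrt p), ?_⟩
  rw [Real.exp_neg, Real.exp_log (div_pos hsr hsp), Real.sqrt_mul hp.le, inv_div]
  rw [div_mul_eq_mul_div, div_mul_eq_mul_div, div_add_div _ _ hsp.ne' hsr.ne',
    eq_div_iff (mul_pos hsp hsr).ne']
  nlinarith [hp', hr']

end scalar

/-! ## The normal-form pencil `u^e • diag(−1,1) + ∑ₖ u^{dₖ} • Pₖ` -/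

section pencil

variable {K : ℕ}

/-- A non-negative combination of PSD letters is PSD: `∑ₖ u^{dₖ} • Pₖ ⪰ 0` for `u ≥ 0`. [folklore] -/
theorem posSemidef_sum_pow_smul (d : Fin K → ℕ) (P : Fin K → Matrix (Fin 2) (Fin 2) ℝ)
    (hP : ∀ k, (P k).PosSemidef) {u : ℝ} (hu : 0 ≤ u) : (∑ k, u ^ d k • P k).PosSemidef := by
  classical
  induction (Finset.univ : Finset (Fin K)) using Finset.induction_on with
  | empty => simpa using Matrix.PosSemidef.zero
  | insert a s ha ih =>
    rw [Finset.sum_insert ha]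
    exact ((hP a).smul (pow_nonneg hu _)).add ih

/-- Entries of the evaluated normal-form pencil. [folklore] -/
theorem eval_pencil_apply (e : ℕ) (d : Fin K → ℕ) (P : Fin K → Matrix (Fin 2) (Fin 2) ℝ) (u : ℝ) (i j : Fin 2) :
    (u ^ e • (!![-1, 0; 0, 1] : Matrix (Fin 2) (Fin 2) ℝ) + ∑ k, u ^ d k • P k) i j
      = u ^ e * (!![-1, 0; 0, 1] : Matrix (Fin 2) (Fin 2) ℝ) i j + ∑ k, u ^ d k * P k i j := by
  simp only [Matrix.add_apply, Matrix.smul_apply, Matrix.sum_apply, smul_eq_mul]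

/-- **`det F(u) = (α(u) − u^e)(ν(u) + u^e) − β̂(u)·β̂'(u)`** for the normal-form pencil, with `α, ν, β̂, β̂'` the
`(0,0), (1,1), (0,1), (1,0)` entries of `A(u) = ∑ₖ u^{dₖ} Pₖ`. [folklore] -/
theorem det_eval_normalForm (e : ℕ) (d : Fin K → ℕ) (P : Fin K → Matrix (Fin 2) (Fin 2) ℝ) (u : ℝ) :
    (Matrix.det (((X : ℝ[X]) ^ e) • (!![-1, 0; 0, 1] : Matrix (Fin 2) (Fin 2) ℝ).map Polynomial.C
        + ∑ k, ((X : ℝ[X]) ^ d k) • (P k).map Polynomial.C)).eval u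
      = ((∑ k, u ^ d k * P k 0 0) - u ^ e) * ((∑ k, u ^ d k * P k 1 1) + u ^ e)
          - (∑ k, u ^ d k * P k 0 1) * (∑ k, u ^ d k * P k 1 0) := by
  rw [eval_det_pivot, Matrix.det_fin_two, eval_pencil_apply, eval_pencil_apply, eval_pencil_apply, eval_pencil_apply]
  simp
  ring

/-- The scalar facts about `A(u) = ∑ₖ u^{dₖ} Pₖ` (`u ≥ 0`, `Pₖ ⪰ 0`): `α ≥ 0`, `ν ≥ 0`, `β̂' = β̂`, `β̂² ≤ α ν`. [folklore] -/
theorem aggregate_facts (d : Fin K → ℕ) (P : Fin K → Matrix (Fin 2) (Fin 2) ℝ) (hP : ∀ k, (P k).PosSemidef)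
    {u : ℝ} (hu : 0 ≤ u) :
    0 ≤ ∑ k, u ^ d k * P k 0 0 ∧ 0 ≤ ∑ k, u ^ d k * P k 1 1 ∧
      (∑ k, u ^ d k * P k 1 0) = (∑ k, u ^ d k * P k 0 1) ∧
      (∑ k, u ^ d k * P k 0 1) * (∑ k, u ^ d k * P k 0 1) ≤ (∑ k, u ^ d k * P k 0 0) * (∑ k, u ^ d k * P k 1 1) := by
  have h := Pivot.TwoDescartes.psd_two_facts (posSemidef_sum_pow_smul d P hP hu)
  simp only [Matrix.sum_apply, Matrix.smul_apply, smul_eq_mul] at h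
  exact h

/-- **THE SCALAR ENVELOPE.**  For `u > 0` and PSD letters, `u` is a root of `det (X^e • diag(−1,1) + ∑ X^{dₖ} • Pₖ)` iff
`u^e = ½(α(u) − ν(u)) + ½ √((α(u) + ν(u))² − 4 β̂(u)²)`. [folklore] -/
theorem isRoot_iff_pow_eq (e : ℕ) (d : Fin K → ℕ) (P : Fin K → Matrix (Fin 2) (Fin 2) ℝ)
    (hP : ∀ k, (P k).PosSemidef) {u : ℝ} (hu : 0 < u) :
    (Matrix.det (((X : ℝ[X]) ^ e) • (!![-1, 0; 0, 1] : Matrix (Fin 2) (Fin 2) ℝ).map Polynomial.C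
        + ∑ k, ((X : ℝ[X]) ^ d k) • (P k).map Polynomial.C)).eval u = 0
      ↔ u ^ e = ((∑ k, u ^ d k * P k 0 0) - (∑ k, u ^ d k * P k 1 1)) / 2
          + Real.sqrt (((∑ k, u ^ d k * P k 0 0) + (∑ k, u ^ d k * P k 1 1)) ^ 2
              - 4 * (∑ k, u ^ d k * P k 0 1) ^ 2) / 2 := by
  obtain ⟨-, -, hsym, hcs⟩ := aggregate_facts d P hP hu.le
  rw [det_eval_normalForm, hsym]
  exact quad_eq_zero_iff hcs (pow_pos hu e)

/-- **`det F(u) ≥ 0 ⟺ u^e ≤ envelope`** (`u > 0`, PSD letters); since `F(u)₁₁ > 0`, `det F(u) ≥ 0` is `F(u) ⪰ 0`.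
[folklore] -/
theorem det_nonneg_iff_pow_le (e : ℕ) (d : Fin K → ℕ) (P : Fin K → Matrix (Fin 2) (Fin 2) ℝ)
    (hP : ∀ k, (P k).PosSemidef) {u : ℝ} (hu : 0 < u) :
    0 ≤ (Matrix.det (((X : ℝ[X]) ^ e) • (!![-1, 0; 0, 1] : Matrix (Fin 2) (Fin 2) ℝ).map Polynomial.C
        + ∑ k, ((X : ℝ[X]) ^ d k) • (P k).map Polynomial.C)).eval u
      ↔ u ^ e ≤ ((∑ k, u ^ d k * P k 0 0) - (∑ k, u ^ d k * P k 1 1)) / 2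
          + Real.sqrt (((∑ k, u ^ d k * P k 0 0) + (∑ k, u ^ d k * P k 1 1)) ^ 2
              - 4 * (∑ k, u ^ d k * P k 0 1) ^ 2) / 2 := by
  obtain ⟨-, -, hsym, hcs⟩ := aggregate_facts d P hP hu.le
  rw [det_eval_normalForm, hsym]
  exact quad_nonneg_iff hcs (pow_pos hu e)

end pencil

/-! ## Light-cone frame: `p̃ₖ = ¼(P₀₀+P₁₁+2P₀₁)`, `r̃ₖ = ¼(P₀₀+P₁₁−2P₀₁)`, `β̃ₖ = ½(P₀₀−P₁₁)`, and the AM–GM envelope -/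

section envelope

variable {K : ℕ}

/-- **The letters lie in the cone.**  For a PSD `2 × 2` matrix `P`: `p̃ ≥ 0`, `r̃ ≥ 0` and `β̃² ≤ 4 p̃ r̃`
(`4 p̃ r̃ − β̃² = det P`). [folklore] -/
theorem letter_cone {P : Matrix (Fin 2) (Fin 2) ℝ} (hP : P.PosSemidef) :
    0 ≤ (P 0 0 + P 1 1 + 2 * P 0 1) / 4 ∧ 0 ≤ (P 0 0 + P 1 1 - 2 * P 0 1) / 4 ∧
      ((P 0 0 - P 1 1) / 2) ^ 2 ≤ 4 * ((P 0 0 + P 1 1 + 2 * P 0 1) / 4) * ((P 0 0 + P 1 1 - 2 * P 0 1) / 4) := by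
  obtain ⟨h00, h11, -, hcs⟩ := Pivot.TwoDescartes.psd_two_facts hP
  refine ⟨?_, ?_, by nlinarith⟩
  · nlinarith [sq_nonneg (P 0 0 - P 1 1), sq_nonneg (P 0 0 + P 1 1 + 2 * P 0 1),
      sq_nonneg (P 0 0 + P 1 1 - 2 * P 0 1)]
  · nlinarith [sq_nonneg (P 0 0 - P 1 1), sq_nonneg (P 0 0 + P 1 1 + 2 * P 0 1),
      sq_nonneg (P 0 0 + P 1 1 - 2 * P 0 1)]

/-- The three light-cone `K`-nomials in terms of the entries of `A(u)`. [folklore] -/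
theorem lightCone_sums (d : Fin K → ℕ) (P : Fin K → Matrix (Fin 2) (Fin 2) ℝ) (u : ℝ) :
    (∑ k, (P k 0 0 + P k 1 1 + 2 * P k 0 1) / 4 * u ^ d k)
        = ((∑ k, u ^ d k * P k 0 0) + (∑ k, u ^ d k * P k 1 1) + 2 * (∑ k, u ^ d k * P k 0 1)) / 4 ∧
      (∑ k, (P k 0 0 + P k 1 1 - 2 * P k 0 1) / 4 * u ^ d k)
        = ((∑ k, u ^ d k * P k 0 0) + (∑ k, u ^ d k * P k 1 1) - 2 * (∑ k, u ^ d k * P k 0 1)) / 4 ∧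
      (∑ k, (P k 0 0 - P k 1 1) / 2 * u ^ d k)
        = ((∑ k, u ^ d k * P k 0 0) - (∑ k, u ^ d k * P k 1 1)) / 2 := by
  refine ⟨?_, ?_, ?_⟩
  · rw [eq_div_iff (by norm_num : (4:ℝ) ≠ 0), Finset.sum_mul, Finset.mul_sum, ← Finset.sum_add_distrib,
      ← Finset.sum_add_distrib]
    exact Finset.sum_congr rfl fun k _ => by ring
  · rw [eq_div_iff (by norm_num : (4:ℝ) ≠ 0), Finset.sum_mul, Finset.mul_sum, ← Finset.sum_add_distrib,
      ← Finset.sum_sub_distrib]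
    exact Finset.sum_congr rfl fun k _ => by ring
  · rw [eq_div_iff (by norm_num : (2:ℝ) ≠ 0), Finset.sum_mul, ← Finset.sum_sub_distrib]
    exact Finset.sum_congr rfl fun k _ => by ring

/-- **THE SCALAR ENVELOPE IN THE LIGHT-CONE FRAME.**  For `u > 0` and PSD letters, `u` is a root of
`det (X^e • diag(−1,1) + ∑ X^{dₖ} • Pₖ)` iff `u^e = β̃(u) + 2 √(p̃(u) r̃(u))` with `p̃, r̃, β̃` the `K`-nomials
`∑ p̃ₖ u^{dₖ}`, `∑ r̃ₖ u^{dₖ}`, `∑ β̃ₖ u^{dₖ}`. [folklore] -/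
theorem isRoot_iff_pow_eq_envelope (e : ℕ) (d : Fin K → ℕ) (P : Fin K → Matrix (Fin 2) (Fin 2) ℝ)
    (hP : ∀ k, (P k).PosSemidef) {u : ℝ} (hu : 0 < u) :
    (Matrix.det (((X : ℝ[X]) ^ e) • (!![-1, 0; 0, 1] : Matrix (Fin 2) (Fin 2) ℝ).map Polynomial.C
        + ∑ k, ((X : ℝ[X]) ^ d k) • (P k).map Polynomial.C)).eval u = 0
      ↔ u ^ e = (∑ k, (P k 0 0 - P k 1 1) / 2 * u ^ d k)
          + 2 * Real.sqrt ((∑ k, (P k 0 0 + P k 1 1 + 2 * P k 0 1) / 4 * u ^ d k)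
              * (∑ k, (P k 0 0 + P k 1 1 - 2 * P k 0 1) / 4 * u ^ d k)) := by
  obtain ⟨hp, hr, hb⟩ := lightCone_sums d P u
  rw [isRoot_iff_pow_eq e d P hP hu, hp, hr, hb, ← half_sqrt_disc_eq]

/-- `det F(u) ≥ 0 ⟺ u^e ≤ β̃(u) + 2 √(p̃(u) r̃(u))` (`u > 0`, PSD letters). [folklore] -/
theorem det_nonneg_iff_pow_le_envelope (e : ℕ) (d : Fin K → ℕ) (P : Fin K → Matrix (Fin 2) (Fin 2) ℝ)
    (hP : ∀ k, (P k).PosSemidef) {u : ℝ} (hu : 0 < u) :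
    0 ≤ (Matrix.det (((X : ℝ[X]) ^ e) • (!![-1, 0; 0, 1] : Matrix (Fin 2) (Fin 2) ℝ).map Polynomial.C
        + ∑ k, ((X : ℝ[X]) ^ d k) • (P k).map Polynomial.C)).eval u
      ↔ u ^ e ≤ (∑ k, (P k 0 0 - P k 1 1) / 2 * u ^ d k)
          + 2 * Real.sqrt ((∑ k, (P k 0 0 + P k 1 1 + 2 * P k 0 1) / 4 * u ^ d k)
              * (∑ k, (P k 0 0 + P k 1 1 - 2 * P k 0 1) / 4 * u ^ d k)) := by
  obtain ⟨hp, hr, hb⟩ := lightCone_sums d P u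
  rw [det_nonneg_iff_pow_le e d P hP hu, hp, hr, hb, ← half_sqrt_disc_eq]

/-- **Posynomial coefficients.**  For cone data `p, r ≥ 0`, `b² ≤ 4 p r` and every `z`:
`0 ≤ e^z p + b + e^{−z} r`. [folklore] -/
theorem coeff_posynomial_nonneg {p r b : ℝ} (hp : 0 ≤ p) (hr : 0 ≤ r) (hb : b ^ 2 ≤ 4 * p * r) (z : ℝ) :
    0 ≤ Real.exp z * p + b + Real.exp (-z) * r := by
  have h1 := two_sqrt_mul_le_exp p r z hp hr
  have h2 : |b| ≤ 2 * Real.sqrt (p * r) := by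
    have := Real.abs_le_sqrt (show b ^ 2 ≤ 4 * (p * r) by linarith)
    rwa [Real.sqrt_mul (by norm_num : (0:ℝ) ≤ 4), show (4:ℝ) = 2 ^ 2 by norm_num,
      Real.sqrt_sq (by norm_num : (0:ℝ) ≤ 2)] at this
  have h3 := neg_abs_le b
  linarith

/-- **ENVELOPE ≤ EVERY POSYNOMIAL.**  For cone data and `u ≥ 0`, for every `z`:
`∑ bₖ u^{dₖ} + 2√((∑ pₖu^{dₖ})(∑ rₖu^{dₖ})) ≤ ∑ₖ (e^z pₖ + bₖ + e^{−z} rₖ) u^{dₖ}` — the envelope is the lower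
envelope of a one-parameter family of `K`-nomials with NON-NEGATIVE coefficients on the support `{dₖ}`. [folklore] -/
theorem envelope_le_posynomial (d : Fin K → ℕ) (p r b : Fin K → ℝ) (hp : ∀ k, 0 ≤ p k) (hr : ∀ k, 0 ≤ r k)
    {u : ℝ} (hu : 0 ≤ u) (z : ℝ) :
    (∑ k, b k * u ^ d k) + 2 * Real.sqrt ((∑ k, p k * u ^ d k) * (∑ k, r k * u ^ d k))
      ≤ ∑ k, (Real.exp z * p k + b k + Real.exp (-z) * r k) * u ^ d k := by
  have hπ : 0 ≤ ∑ k, p k * u ^ d k := Finset.sum_nonneg fun k _ => mul_nonneg (hp k) (pow_nonneg hu _)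
  have hρ : 0 ≤ ∑ k, r k * u ^ d k := Finset.sum_nonneg fun k _ => mul_nonneg (hr k) (pow_nonneg hu _)
  have h := two_sqrt_mul_le_exp _ _ z hπ hρ
  have hsplit : ∑ k, (Real.exp z * p k + b k + Real.exp (-z) * r k) * u ^ d k
      = Real.exp z * (∑ k, p k * u ^ d k) + (∑ k, b k * u ^ d k) + Real.exp (-z) * (∑ k, r k * u ^ d k) := by
    rw [Finset.mul_sum, Finset.mul_sum, ← Finset.sum_add_distrib, ← Finset.sum_add_distrib]
    exact Finset.sum_congr rfl fun k _ => by ring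
  rw [hsplit]
  linarith

/-- **The envelope is attained** when both `∑ pₖu^{dₖ}` and `∑ rₖu^{dₖ}` are positive: some member of the family
touches it at `u`. [folklore] -/
theorem exists_envelope_eq_posynomial (d : Fin K → ℕ) (p r b : Fin K → ℝ) {u : ℝ}
    (hπ : 0 < ∑ k, p k * u ^ d k) (hρ : 0 < ∑ k, r k * u ^ d k) :
    ∃ z : ℝ, (∑ k, b k * u ^ d k) + 2 * Real.sqrt ((∑ k, p k * u ^ d k) * (∑ k, r k * u ^ d k))
      = ∑ k, (Real.exp z * p k + b k + Real.exp (-z) * r k) * u ^ d k := by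
  obtain ⟨z, hz⟩ := exists_two_sqrt_mul_eq_exp _ _ hπ hρ
  refine ⟨z, ?_⟩
  have hsplit : ∑ k, (Real.exp z * p k + b k + Real.exp (-z) * r k) * u ^ d k
      = Real.exp z * (∑ k, p k * u ^ d k) + (∑ k, b k * u ^ d k) + Real.exp (-z) * (∑ k, r k * u ^ d k) := by
    rw [Finset.mul_sum, Finset.mul_sum, ← Finset.sum_add_distrib, ← Finset.sum_add_distrib]
    exact Finset.sum_congr rfl fun k _ => by ring
  rw [hsplit, hz]; ring

/-- **At a root, `u^e` is below every posynomial of the family**: if `u > 0` is a determinant root of the normal-form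
pencil then `u^e ≤ ∑ₖ (e^z p̃ₖ + β̃ₖ + e^{−z} r̃ₖ) u^{dₖ}` for every real `z`. [folklore] -/
theorem pow_le_posynomial_of_isRoot (e : ℕ) (d : Fin K → ℕ) (P : Fin K → Matrix (Fin 2) (Fin 2) ℝ)
    (hP : ∀ k, (P k).PosSemidef) {u : ℝ} (hu : 0 < u)
    (hroot : (Matrix.det (((X : ℝ[X]) ^ e) • (!![-1, 0; 0, 1] : Matrix (Fin 2) (Fin 2) ℝ).map Polynomial.C
        + ∑ k, ((X : ℝ[X]) ^ d k) • (P k).map Polynomial.C)).eval u = 0) (z : ℝ) :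
    u ^ e ≤ ∑ k, (Real.exp z * ((P k 0 0 + P k 1 1 + 2 * P k 0 1) / 4) + (P k 0 0 - P k 1 1) / 2
        + Real.exp (-z) * ((P k 0 0 + P k 1 1 - 2 * P k 0 1) / 4)) * u ^ d k := by
  rw [(isRoot_iff_pow_eq_envelope e d P hP hu).1 hroot]
  exact envelope_le_posynomial d _ _ _ (fun k => (letter_cone (hP k)).1) (fun k => (letter_cone (hP k)).2.1) hu.le z

end envelope

/-! ## The scalar reduction of the `m = 2` pivot rows -/

section reduction

variable {K : ℕ}

/-- **Any finite set containing the positive solutions of the scalar equation bounds `Z₊`** (normal-form pencil,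
PSD letters). [folklore] -/
theorem pivotPosRoots_normalForm_le_card (e : ℕ) (d : Fin K → ℕ) (P : Fin K → Matrix (Fin 2) (Fin 2) ℝ)
    (hP : ∀ k, (P k).PosSemidef) (S : Finset ℝ)
    (hS : ∀ u : ℝ, 0 < u →
      u ^ e = (∑ k, (P k 0 0 - P k 1 1) / 2 * u ^ d k)
          + 2 * Real.sqrt ((∑ k, (P k 0 0 + P k 1 1 + 2 * P k 0 1) / 4 * u ^ d k)
              * (∑ k, (P k 0 0 + P k 1 1 - 2 * P k 0 1) / 4 * u ^ d k)) → u ∈ S) :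
    pivotPosRoots e d !![-1, 0; 0, 1] P ≤ S.card := by
  unfold pivotPosRoots
  refine Finset.card_le_card fun u hu => ?_
  rw [Finset.mem_filter, Multiset.mem_toFinset, Polynomial.mem_roots'] at hu
  exact hS u hu.2 ((isRoot_iff_pow_eq_envelope e d P hP hu.2).1 hu.1.2)

/-- **THE `m = 2` PIVOT LAW IS A STATEMENT ABOUT ONE SCALAR EQUATION.**  If for all exponents and all cone data
`pₖ, rₖ ≥ 0`, `bₖ² ≤ 4 pₖ rₖ` the equation `u^e = ∑ bₖ u^{dₖ} + 2 √((∑ pₖ u^{dₖ})(∑ rₖ u^{dₖ}))` has at most `2K`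
positive solutions, then `PivotRootLawAt 2 K q (2K)` holds at every index `q`. [folklore] -/
theorem pivotRootLawAt_two_of_scalar (K q : ℕ)
    (h : ∀ (e : ℕ) (d : Fin K → ℕ) (p r b : Fin K → ℝ), (∀ k, 0 ≤ p k) → (∀ k, 0 ≤ r k) →
      (∀ k, b k ^ 2 ≤ 4 * p k * r k) →
      ∃ S : Finset ℝ, S.card ≤ 2 * K ∧ ∀ u : ℝ, 0 < u →
        u ^ e = (∑ k, b k * u ^ d k) + 2 * Real.sqrt ((∑ k, p k * u ^ d k) * (∑ k, r k * u ^ d k)) → u ∈ S) :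
    PivotRootLawAt 2 K q (2 * K) := by
  refine TwoNormalForm.pivotRootLawAt_two_of_normalForm K q fun e d P hP => ?_
  obtain ⟨S, hcard, hS⟩ := h e d (fun k => (P k 0 0 + P k 1 1 + 2 * P k 0 1) / 4)
    (fun k => (P k 0 0 + P k 1 1 - 2 * P k 0 1) / 4) (fun k => (P k 0 0 - P k 1 1) / 2)
    (fun k => (letter_cone (hP k)).1) (fun k => (letter_cone (hP k)).2.1) (fun k => (letter_cone (hP k)).2.2)
  exact (pivotPosRoots_normalForm_le_card e d P hP S hS).trans hcard

end reduction

end Summit.ValiantsHypothesis.ValiantsHypothesis.Theorems.LacunarySymmetroidMatrixDescartes.Pivot.TwoEnvelope
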